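import Summits.CriticalPhenomena.PercolationContinuityZ3.Theorems.PercNonProliferationSubpolynomialBlockingStubUpperSandwich
import HarnessLib

/-!
# Crux `PercNonProliferation.SubpolynomialBlocking` (stmt-CriticalPhenomena-4446), line `cross-sandwich-flat-seal` — stub `stub_upperSeedSandwich`

Helper file for the crux skeleton of line `cross-sandwich-flat-seal` (lead
prover-line-stmt-CriticalPhenomena-4446-0). Proves exactly the registered stub signature
`stub_upperSeedSandwich`; lands with `--supports stmt-CriticalPhenomena-4446`.

## The statement (second necessity certificate `u_n ≤ seed_k(n)⁶`, `k ≥ 2`, `n ≥ 3`)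

`u_n := blockProb 3 p_c n = P_{p_c}((annulusCrossing 3 n)ᶜ)` ("no open path inside `Λ_{2n}` from
`Λ_n` to `∂ⁱⁿΛ_{2n}`") is at most the sixth power of `seed_k(n) := P_{p_c}` (the flat SEED box
`[0,n] × [0, n + ⌊n/k⌋]² = Set.Icc 0 ![n, n + n/k, n + n/k]` is SEALED across direction `0`, i.e. the
complement of the `openCrossing` event between its faces `{x₀ = 0}` and `{x₀ = n}` inside the box).

## The argument (Grimmett 1999, §1.6 lattice symmetry, §2.2 product measure; folklore)

This is the landed `stub_upperSandwich` (module `…StubUpperSandwich`, whose measure-theoretic helpers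
`real_iInter_compl_openCrossing`, `real_compl_openCrossing_image`,
`openCrossing_subset_annulusCrossing` are reused verbatim) with the cube replaced by the seed box;
only the lattice geometry of the six boxes changes. Write `m := ⌊n/k⌋`; the hypotheses `k ≥ 2`,
`n ≥ 3` are used only through `m + 2 ≤ n` (`⌊n/k⌋ ≤ ⌊n/2⌋ ≤ n - 2`).

* Six boxes. Shift the seed box by `(n, 1-n, 1-n)` to `B = [n,2n] × [1-n, m+1]²` (`zdShiftIso`) and
  apply the six signed coordinate permutations `z ↦ (i' ↦ s · z (swap 0 i ⁻¹ i'))`, `i : Fin 3`,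
  `s = ±1` (`zdSignedPermIso (Equiv.swap 0 i) (fun _ => s)`). The six images lie inside `Λ_{2n}`
  (`image_seed_subset_box`), with inner face (image of `{x₀ = 0}`) inside `Λ_n`
  (`image_seedInnerFace_subset_box`, uses `m + 1 ≤ n`) and outer face (image of `{x₀ = n}`) on
  `∂ⁱⁿΛ_{2n}` (`image_seedOuterFace_subset_innerBoundary`); they are pairwise VERTEX-disjoint when
  `m + 2 ≤ n`: along its own axis `i` a point of box `(i,s)` has `|z_i| ≥ n` and `s z_i > 0`, across
  it `|z_j| ≤ max (n-1) (m+1) = n-1` (`pairwise_disjoint_image_seed`).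
* (a) blocking ⊆ each of the six seals (`openCrossing_subset_annulusCrossing`); (b) the six seals are
  independent (`real_iInter_compl_openCrossing`); (c) each has probability `seed_k(n)`
  (`real_compl_openCrossing_image`, twice: signed permutation and shift).

Hence `u_n ≤ P(⋂ₗ sealₗ) = ∏ₗ P(sealₗ) = seed_k(n)⁶`. No new definitions; no named facts.
-/

noncomputable section

namespace Summit.CriticalPhenomena.PercolationContinuityZ3.Theorems.SubpolynomialBlocking

open MeasureTheory Filter Topology ProbabilityTheory
open Literature.Probability.Percolation Literature.Probability.LatticeModels
open Literature.Probability.Percolation.DCT16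
open Literature.Barriers.CriticalPhenomena
open Summit.CriticalPhenomena.PercolationContinuityZ3.Theorems.SubpolynomialBlocking.Negative

namespace StubUpperSeedSandwich

/-! ### Geometry of the six seed boxes `σ_{i,s}([n,2n] × [1-n, m+1]²)` -/

/-- Membership in the seed box `[0,n] × [0,n+m]²`, coordinatewise. -/
theorem mem_seed_iff {n m : ℕ} {x : Site 3} :
    x ∈ Set.Icc (0 : Site 3) ![(n : ℤ), (n : ℤ) + (m : ℤ), (n : ℤ) + (m : ℤ)] ↔
      (0 ≤ x 0 ∧ 0 ≤ x 1 ∧ 0 ≤ x 2) ∧ (x 0 ≤ n ∧ x 1 ≤ n + m ∧ x 2 ≤ n + m) := by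
  simp [Set.mem_Icc, Pi.le_def, Fin.forall_fin_succ]

/-- The shifted seed box `[n,2n] × [1-n, m+1]²` lies in `Λ_{2n}` (`m + 2 ≤ n`). -/
theorem seed_shift_mem_box_two_mul {n m : ℕ} (hm : m + 2 ≤ n) {x : Site 3}
    (hx : x ∈ Set.Icc (0 : Site 3) ![(n : ℤ), (n : ℤ) + (m : ℤ), (n : ℤ) + (m : ℤ)]) :
    x + ![(n : ℤ), 1 - (n : ℤ), 1 - (n : ℤ)] ∈ box 3 (2 * n) := by
  rw [mem_seed_iff] at hx
  rw [mem_box]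
  intro j
  fin_cases j <;> simp only [Pi.add_apply] <;> simp <;> omega

/-- The inner face `{n} × [1-n, m+1]²` of the shifted seed box lies in `Λ_n` (`m + 2 ≤ n`). -/
theorem seed_shift_mem_box_of_face {n m : ℕ} (hm : m + 2 ≤ n) {x : Site 3}
    (hx : x ∈ Set.Icc (0 : Site 3) ![(n : ℤ), (n : ℤ) + (m : ℤ), (n : ℤ) + (m : ℤ)]) (h0 : x 0 = 0) :
    x + ![(n : ℤ), 1 - (n : ℤ), 1 - (n : ℤ)] ∈ box 3 n := by
  rw [mem_seed_iff] at hx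
  rw [mem_box]
  intro j
  fin_cases j <;> simp only [Pi.add_apply] <;> simp <;> omega

/-- Each of the six seed boxes lies in `Λ_{2n}`. -/
theorem image_seed_subset_box {n m : ℕ} (hm : m + 2 ≤ n) (i : Fin 3) (s : ℤˣ) :
    zdSignedPermIso (Equiv.swap (0 : Fin 3) i) (fun _ => s) ''
        (zdShiftIso (![(n : ℤ), 1 - (n : ℤ), 1 - (n : ℤ)] : Site 3) ''
          Set.Icc (0 : Site 3) ![(n : ℤ), (n : ℤ) + (m : ℤ), (n : ℤ) + (m : ℤ)]) ⊆
      (↑(box 3 (2 * n)) : Set (Site 3)) := by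
  rintro _ ⟨y, ⟨x, hx, rfl⟩, rfl⟩
  exact (signedPerm_mem_box_iff _ _).2 (seed_shift_mem_box_two_mul hm hx)

/-- The inner face of each of the six seed boxes lies in `Λ_n`. -/
theorem image_seedInnerFace_subset_box {n m : ℕ} (hm : m + 2 ≤ n) (i : Fin 3) (s : ℤˣ) :
    zdSignedPermIso (Equiv.swap (0 : Fin 3) i) (fun _ => s) ''
        (zdShiftIso (![(n : ℤ), 1 - (n : ℤ), 1 - (n : ℤ)] : Site 3) ''
          {x | x ∈ Set.Icc (0 : Site 3) ![(n : ℤ), (n : ℤ) + (m : ℤ), (n : ℤ) + (m : ℤ)] ∧ x 0 = 0}) ⊆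
      (↑(box 3 n) : Set (Site 3)) := by
  rintro _ ⟨y, ⟨x, ⟨hx, h0⟩, rfl⟩, rfl⟩
  exact (signedPerm_mem_box_iff _ _).2 (seed_shift_mem_box_of_face hm hx h0)

/-- The outer face of each of the six seed boxes lies on `∂ⁱⁿΛ_{2n}`. -/
theorem image_seedOuterFace_subset_innerBoundary {n m : ℕ} (hm : m + 2 ≤ n) (i : Fin 3) (s : ℤˣ) :
    zdSignedPermIso (Equiv.swap (0 : Fin 3) i) (fun _ => s) ''
        (zdShiftIso (![(n : ℤ), 1 - (n : ℤ), 1 - (n : ℤ)] : Site 3) ''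
          {y | y ∈ Set.Icc (0 : Site 3) ![(n : ℤ), (n : ℤ) + (m : ℤ), (n : ℤ) + (m : ℤ)] ∧
            y 0 = (n : ℤ)}) ⊆
      (↑(innerBoundary (zdGraph 3) (box 3 (2 * n))) : Set (Site 3)) := by
  rintro _ ⟨y, ⟨x, ⟨hx, h0⟩, rfl⟩, rfl⟩
  refine mem_innerBoundary_box_of_natAbs_eq (i := i)
    ((signedPerm_mem_box_iff _ _).2 (seed_shift_mem_box_two_mul hm hx)) ?_
  simp only [zdSignedPermIso_apply, Site.signedPerm_apply, Equiv.symm_swap, Equiv.swap_apply_right,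
    zdShiftIso_apply, Pi.add_apply, Matrix.cons_val_zero, h0, Int.natAbs_mul, Int.units_natAbs,
    one_mul]
  omega

/-- Along its own axis `i`, the seed box `(i, s)` has `|z_i| ≥ n` and `s z_i > 0` (`m + 2 ≤ n`). -/
theorem natAbs_apply_self_of_mem_image_seed {n m : ℕ} (hm : m + 2 ≤ n) (i : Fin 3) (s : ℤˣ)
    {z : Site 3}
    (hz : z ∈ zdSignedPermIso (Equiv.swap (0 : Fin 3) i) (fun _ => s) ''
        (zdShiftIso (![(n : ℤ), 1 - (n : ℤ), 1 - (n : ℤ)] : Site 3) ''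
          Set.Icc (0 : Site 3) ![(n : ℤ), (n : ℤ) + (m : ℤ), (n : ℤ) + (m : ℤ)])) :
    n ≤ (z i).natAbs ∧ 0 < (s : ℤ) * z i := by
  obtain ⟨y, ⟨x, hx, rfl⟩, rfl⟩ := hz
  rw [mem_seed_iff] at hx
  simp only [zdSignedPermIso_apply, Site.signedPerm_apply, Equiv.symm_swap, Equiv.swap_apply_right,
    zdShiftIso_apply, Pi.add_apply, Matrix.cons_val_zero, ← mul_assoc, Int.units_coe_mul_self,
    one_mul, Int.natAbs_mul, Int.units_natAbs]
  omega

/-- Across its axis, the seed box `(i, s)` has `|z_j| ≤ n - 1` for `j ≠ i` (`m + 2 ≤ n`). -/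
theorem natAbs_apply_ne_of_mem_image_seed {n m : ℕ} (hm : m + 2 ≤ n) (i : Fin 3) (s : ℤˣ)
    {z : Site 3}
    (hz : z ∈ zdSignedPermIso (Equiv.swap (0 : Fin 3) i) (fun _ => s) ''
        (zdShiftIso (![(n : ℤ), 1 - (n : ℤ), 1 - (n : ℤ)] : Site 3) ''
          Set.Icc (0 : Site 3) ![(n : ℤ), (n : ℤ) + (m : ℤ), (n : ℤ) + (m : ℤ)]))
    {j : Fin 3} (hj : j ≠ i) : (z j).natAbs + 1 ≤ n := by
  obtain ⟨y, ⟨x, hx, rfl⟩, rfl⟩ := hz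
  rw [mem_seed_iff] at hx
  have hc : Equiv.swap (0 : Fin 3) i j ≠ 0 := by
    rw [Ne, Equiv.swap_apply_eq_iff, Equiv.swap_apply_left]
    exact hj
  generalize hc' : Equiv.swap (0 : Fin 3) i j = c at hc
  simp only [zdSignedPermIso_apply, Site.signedPerm_apply, Equiv.symm_swap, hc', zdShiftIso_apply,
    Pi.add_apply, Int.natAbs_mul, Int.units_natAbs, one_mul]
  fin_cases c
  · exact absurd rfl hc
  · simp; omega
  · simp; omega

/-- The six seed boxes are pairwise vertex-disjoint (`m + 2 ≤ n`). -/
theorem pairwise_disjoint_image_seed {n m : ℕ} (hm : m + 2 ≤ n) :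
    Pairwise fun k l : Fin 3 × ℤˣ => Disjoint
      (zdSignedPermIso (Equiv.swap (0 : Fin 3) k.1) (fun _ => k.2) ''
        (zdShiftIso (![(n : ℤ), 1 - (n : ℤ), 1 - (n : ℤ)] : Site 3) ''
          Set.Icc (0 : Site 3) ![(n : ℤ), (n : ℤ) + (m : ℤ), (n : ℤ) + (m : ℤ)]))
      (zdSignedPermIso (Equiv.swap (0 : Fin 3) l.1) (fun _ => l.2) ''
        (zdShiftIso (![(n : ℤ), 1 - (n : ℤ), 1 - (n : ℤ)] : Site 3) ''
          Set.Icc (0 : Site 3) ![(n : ℤ), (n : ℤ) + (m : ℤ), (n : ℤ) + (m : ℤ)])) := by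
  rintro ⟨i, s⟩ ⟨j, t⟩ hkl
  rw [Set.disjoint_left]
  intro z hz hz'
  by_cases hij : i = j
  · subst hij
    have hst : s ≠ t := fun h => hkl (by rw [h])
    have h1 := (natAbs_apply_self_of_mem_image_seed hm i s hz).2
    have h2 := (natAbs_apply_self_of_mem_image_seed hm i t hz').2
    rw [Int.units_ne_iff_eq_neg] at hst
    subst hst
    rw [Units.val_neg, neg_mul] at h1
    omega
  · have h1 := (natAbs_apply_self_of_mem_image_seed hm i s hz).1
    have h2 := natAbs_apply_ne_of_mem_image_seed hm j t hz' hij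
    omega

end StubUpperSeedSandwich

open StubUpperSandwich StubUpperSeedSandwich in
/-- **Registered stub `stub_upperSeedSandwich`** (second necessity certificate of line
`cross-sandwich-flat-seal`): `u_n ≤ seed_k(n)⁶` for `k ≥ 2`, `n ≥ 3` — the blocking event
`(annulusCrossing 3 n)ᶜ` lies in the sealing event of each of six pairwise vertex-disjoint lattice
boxes in the shell `Λ_{2n} ∖ Λ_{n-1}` (signed coordinate permutations of `[n,2n] × [1-n, ⌊n/k⌋+1]²`),
these six events are independent (disjoint edge sets, product measure) and each has the probability
`seed_k(n)` of sealing the seed box `[0,n] × [0, n + ⌊n/k⌋]²` across direction `0` (lattice symmetry). -/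
theorem stub_upperSeedSandwich :
    ∀ k n : ℕ, 2 ≤ k → 3 ≤ n →
      blockProb 3 (criticalProbI 3) n ≤
        (bondPercolation (zdGraph 3) (criticalProbI 3)).real
          (openCrossing (Set.Icc (0 : Site 3) ![(n : ℤ), (n : ℤ) + (n / k : ℕ), (n : ℤ) + (n / k : ℕ)])
            {x | x ∈ Set.Icc (0 : Site 3) ![(n : ℤ), (n : ℤ) + (n / k : ℕ), (n : ℤ) + (n / k : ℕ)] ∧ x 0 = 0}
            {y | y ∈ Set.Icc (0 : Site 3) ![(n : ℤ), (n : ℤ) + (n / k : ℕ), (n : ℤ) + (n / k : ℕ)] ∧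
              y 0 = (n : ℤ)})ᶜ ^ 6 := by
  intro k n hk hn
  -- the only arithmetic used: `⌊n/k⌋ + 2 ≤ n` (`⌊n/k⌋ ≤ ⌊n/2⌋ ≤ n - 2` for `k ≥ 2`, `n ≥ 3`)
  have hm : n / k + 2 ≤ n := by
    have h1 : n / k ≤ n / 2 := Nat.div_le_div_left hk two_pos
    omega
  -- the six seed boxes, their inner and outer faces, as images of the seed box and its two faces
  set C : Set (Site 3) :=
    Set.Icc (0 : Site 3) ![(n : ℤ), (n : ℤ) + (n / k : ℕ), (n : ℤ) + (n / k : ℕ)]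
  set A : Set (Site 3) :=
    {x | x ∈ Set.Icc (0 : Site 3) ![(n : ℤ), (n : ℤ) + (n / k : ℕ), (n : ℤ) + (n / k : ℕ)] ∧ x 0 = 0}
  set B : Set (Site 3) :=
    {y | y ∈ Set.Icc (0 : Site 3) ![(n : ℤ), (n : ℤ) + (n / k : ℕ), (n : ℤ) + (n / k : ℕ)] ∧
      y 0 = (n : ℤ)}
  set τ : zdGraph 3 ≃g zdGraph 3 := zdShiftIso (![(n : ℤ), 1 - (n : ℤ), 1 - (n : ℤ)] : Site 3)
  set ψ : Fin 3 × ℤˣ → zdGraph 3 ≃g zdGraph 3 :=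
    fun l => zdSignedPermIso (Equiv.swap (0 : Fin 3) l.1) (fun _ => l.2)
  set μ := bondPercolation (zdGraph 3) (criticalProbI 3) with hμ
  -- (a) blocking ⊆ each seal
  have hsub : (annulusCrossing 3 n)ᶜ ⊆
      ⋂ l, (openCrossing (ψ l '' (τ '' C)) (ψ l '' (τ '' A)) (ψ l '' (τ '' B)))ᶜ := by
    refine Set.subset_iInter fun l => Set.compl_subset_compl.2 ?_
    exact openCrossing_subset_annulusCrossing (image_seed_subset_box hm l.1 l.2)
      (image_seedInnerFace_subset_box hm l.1 l.2)
      (image_seedOuterFace_subset_innerBoundary hm l.1 l.2)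
  -- (b) independence
  have hprod : μ.real (⋂ l, (openCrossing (ψ l '' (τ '' C)) (ψ l '' (τ '' A)) (ψ l '' (τ '' B)))ᶜ) =
      ∏ l, μ.real (openCrossing (ψ l '' (τ '' C)) (ψ l '' (τ '' A)) (ψ l '' (τ '' B)))ᶜ :=
    real_iInter_compl_openCrossing (zdGraph 3) (criticalProbI 3) (fun l => ψ l '' (τ '' C))
      (fun l => ψ l '' (τ '' A)) (fun l => ψ l '' (τ '' B)) (pairwise_disjoint_image_seed hm)
  -- (c) symmetry
  have hsymm : ∀ l, μ.real (openCrossing (ψ l '' (τ '' C)) (ψ l '' (τ '' A)) (ψ l '' (τ '' B)))ᶜ =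
      μ.real (openCrossing C A B)ᶜ := fun l => by
    rw [hμ, real_compl_openCrossing_image, real_compl_openCrossing_image]
  calc blockProb 3 (criticalProbI 3) n = μ.real (annulusCrossing 3 n)ᶜ := rfl
    _ ≤ μ.real (⋂ l, (openCrossing (ψ l '' (τ '' C)) (ψ l '' (τ '' A)) (ψ l '' (τ '' B)))ᶜ) :=
        measureReal_mono hsub
    _ = ∏ _l : Fin 3 × ℤˣ, μ.real (openCrossing C A B)ᶜ := by
        rw [hprod]; exact Finset.prod_congr rfl fun l _ => hsymm l
    _ = μ.real (openCrossing C A B)ᶜ ^ 6 := by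
        rw [Finset.prod_const, Finset.card_univ, Fintype.card_prod, Fintype.card_fin,
          Fintype.card_units_int]

end Summit.CriticalPhenomena.PercolationContinuityZ3.Theorems.SubpolynomialBlocking

end
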